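import Literature.NumberTheory.EllipticCurves.CongruenceNumberPrimeProofs
import HarnessLib

/-!
# The congruence quotient `S_k(Γ₀(N); ℤ)/(ℤf + (ℤf)^⊥)` is cyclic: `⟨f, S_k(ℤ)⟩ = (1/r_f) ℤ ⟨f, f⟩`
# and definition (ii) ⇒ (i) in full (Agashe–Ribet–Stein 2012, §2.1; Abbes–Ullmo 1996, Lemme 3.2)

Topic `NumberTheory/EllipticCurves`; a proofs-only companion (theorems only: no definition, no
named fact, nothing restated; D-0026) of `CongruenceNumber.lean` and
`CongruenceNumberPrimeProofs.lean`. Those files record the congruence number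
`r_f = congruenceNumber f = #(S_k(Γ₀(N); ℤ)/(ℤf + (ℤf)^⊥))` (ARS 2012, §2.1, definition (ii)),
prove "(i) ⇒ (ii)" (`dvd_congruenceNumber_of_sub_eq_smul`) and "(ii) ⇒ (i)" AT PRIMES
(`exists_sub_eq_smul_of_prime_dvd_congruenceNumber`), and leave the full converse aside: "the
converse half of (i) ⇔ (ii) (`congruenceNumber f` is itself attained by a congruence), which
needs the cyclicity of the quotient (it embeds in `ℚ⟨f,f⟩/ℤ⟨f,f⟩` via `g ↦ ⟨f, g⟩`)" (design notes
of `CongruenceNumber.lean`). This file proves that cyclicity in the form in which it is used —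
by A. Abbes, E. Ullmo, *À propos de la conjecture de Manin pour les courbes elliptiques
modulaires*, Compositio Math. 103 (1996), proof of Lemme 3.2 (p. 278): "Soit `B` le conoyau du
morphisme `𝕋 → ℤ ⊕ 𝕋'` … c'est un groupe cyclique", with Lemme 3.3
`#B = #(S_ℤ / (L₂ ⊕ ℤ f_E))`, and by ARS 2012 §2.1 — namely:

* `exists_int_congruenceNumber_mul_peterssonProduct_eq` — for `g ∈ S_k(Γ₀(N); ℤ)`,
  `r_f ⟨f, g⟩ = n ⟨f, f⟩` for some `n ∈ ℤ` (the quotient of order `r_f` is killed by `r_f`, and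
  `ℤf + (ℤf)^⊥` pairs with `f` into `ℤ⟨f, f⟩`); no hypothesis on `f` at all.
* `exists_congruenceNumber_mul_peterssonProduct_eq_self` — **the denominator `r_f` is attained**:
  if moreover `0 ≠ f ∈ S_k(Γ₀(N); ℤ)`, there is `g ∈ S_k(Γ₀(N); ℤ)` with `r_f ⟨f, g⟩ = ⟨f, f⟩`, i.e.
  `⟨f, S_k(Γ₀(N); ℤ)⟩ = (1/r_f) ℤ ⟨f, f⟩` exactly. Proof: `g ↦ n(g) mod r_f` (with `n(g)` as above) is
  an additive map `S_k(ℤ) → ℤ/r_f` whose kernel is exactly `ℤf + (ℤf)^⊥` (`n(g) = r_f a` iff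
  `⟨f, g - a f⟩ = 0`), so the quotient of order `r_f` injects into `ℤ/r_f`, hence onto; a preimage
  `g` of `1` has `n(g) = 1 + r_f m`, and `g - m f` works. This is the cyclicity of the quotient
  (it is isomorphic to `ℤ/r_f`).
* `exists_sub_eq_congruenceNumber_smul` — **ARS (ii) ⇒ (i) in full**: there are `g₁ ∈ (ℤf)^⊥` and
  `h ∈ S_k(Γ₀(N); ℤ)` with `f - g₁ = r_f • h` (`aₙ(f) ≡ aₙ(g₁) mod r_f`): take `h = g` above and
  `g₁ = f - r_f • g`. With `dvd_congruenceNumber_of_sub_eq_smul` this makes `r_f` "the largest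
  integer `r` such that there exists `g ∈ (ℤf)^⊥` with `f ≡ g mod r`" (ARS (i)).

Positivity `congruenceNumber f ≠ 0` is an explicit hypothesis throughout (tree convention).
Used by `ManinConstantAbbesUllmoDegreeRouteProofs.lean` (Abbes–Ullmo's Prop. 3.3 in functional
form).

## References

* A. Agashe, K. A. Ribet, W. A. Stein, *The modular degree, congruence primes, and multiplicity
  one*, in: Number Theory, Analysis and Geometry (in memory of S. Lang), Springer 2012, 19–49,
  §2.1 (definitions (i), (ii) of `r_E`). [AgasheRibetStein2012]
* A. Abbes, E. Ullmo, Compositio Math. 103 (1996) 269–286, Lemme 3.2 (proof, p. 278: "`B` … est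
  un groupe cyclique"), Lemme 3.3. [AbbesUllmo1996]
-/

noncomputable section

open scoped MatrixGroups ModularForm

open CongruenceSubgroup UpperHalfPlane

namespace Literature.NumberTheory.EllipticCurves.ModularForms

section Cyclic

variable {N : ℕ} [NeZero N] {k : ℤ}

/-- **`⟨f, S_k(Γ₀(N); ℤ)⟩ ⊆ (1/r_f) ℤ ⟨f, f⟩`.** If `g ∈ S_k(Γ₀(N); ℤ)`, then
`r_f ⟨f, g⟩ = n ⟨f, f⟩` for some integer `n` (`r_f = congruenceNumber f`): the class of `g` in the
group `S_k(Γ₀(N); ℤ)/(ℤf + (ℤf)^⊥)` of order `r_f` is killed by `r_f`, so `r_f • g = a • f + z` with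
`z ⊥ f`, and pairing with `f` gives `r_f ⟨f, g⟩ = a ⟨f, f⟩` (ARS 2012, §2.1; Abbes–Ullmo 1996, proof
of Lemme 3.2). (No positivity hypothesis: for the junk value `r_f = 0` of an infinite quotient the
statement holds with `n = 0`.) [cite: AgasheRibetStein2012, §2.1]
[cite: AbbesUllmo1996, Lemme 3.2 (proof, p. 278)] -/
theorem exists_int_congruenceNumber_mul_peterssonProduct_eq (f : CuspForm (Gamma0 N) k)
    {g : CuspForm (Gamma0 N) k} (hg : g ∈ integralCuspForms0 N k) :
    ∃ n : ℤ, (congruenceNumber f : ℂ) * peterssonProduct (Gamma0 N) k f g =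
      n * peterssonProduct (Gamma0 N) k f f := by
  classical
  set L := integralCuspForms0 N k with hL
  set H : Submodule ℤ L := ((ℤ ∙ f) ⊔ integralOrthogonal0 f).comap L.subtype with hH
  have hcard : Nat.card (L ⧸ H.toAddSubgroup) = congruenceNumber f := rfl
  generalize hrdef : congruenceNumber f = r at hcard ⊢
  let x : L := ⟨g, hg⟩
  -- `r_f • x ∈ ℤf + (ℤf)^⊥`
  have hrx : r • x ∈ H := by
    have h0 : r • (QuotientAddGroup.mk x : L ⧸ H.toAddSubgroup) = 0 := by
      rw [← hcard]
      exact card_nsmul_eq_zero'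
    rwa [← QuotientAddGroup.mk_nsmul, QuotientAddGroup.eq_zero_iff,
      Submodule.mem_toAddSubgroup] at h0
  rw [hH, Submodule.mem_comap, Submodule.subtype_apply, Submodule.mem_sup] at hrx
  obtain ⟨y, hy, z, hz, hyz⟩ := hrx
  obtain ⟨a, rfl⟩ := Submodule.mem_span_singleton.mp hy
  have hPz : peterssonProduct (Gamma0 N) k f z = 0 := (mem_integralOrthogonal0.mp hz).2
  have hcoe : ((r • x : L) : CuspForm (Gamma0 N) k) = ((r : ℕ) : ℤ) • g := by
    rw [Submodule.coe_smul_of_tower, natCast_zsmul]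
  rw [hcoe] at hyz
  refine ⟨a, ?_⟩
  have e := congrArg (peterssonProduct (Gamma0 N) k f) hyz
  rw [peterssonProduct_add_right, peterssonProduct_zsmul_right, peterssonProduct_zsmul_right, hPz,
    add_zero, Int.cast_natCast] at e
  exact e.symm

/-- **The congruence quotient is cyclic: the denominator `r_f` is attained.** If
`0 ≠ f ∈ S_k(Γ₀(N); ℤ)` and `r_f = congruenceNumber f ≠ 0`, there is `g ∈ S_k(Γ₀(N); ℤ)` with
`r_f ⟨f, g⟩ = ⟨f, f⟩`; with `exists_int_congruenceNumber_mul_peterssonProduct_eq`,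
`⟨f, S_k(Γ₀(N); ℤ)⟩ = (1/r_f) ℤ ⟨f, f⟩`, i.e. `g ↦ ⟨f, g⟩/⟨f, f⟩` identifies
`S_k(Γ₀(N); ℤ)/(ℤf + (ℤf)^⊥)` with `(1/r_f)ℤ/ℤ ≅ ℤ/r_f` (Abbes–Ullmo 1996, proof of Lemme 3.2:
"`B` … c'est un groupe cyclique"; ARS 2012 §2.1). Proof: `g ↦ n(g) mod r_f` is additive
`S_k(ℤ) → ℤ/r_f` with kernel `ℤf + (ℤf)^⊥`, so the quotient of order `r_f` maps onto `ℤ/r_f`; lift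
`1` and correct by a multiple of `f`. [cite: AbbesUllmo1996, Lemme 3.2 (proof, p. 278)]
[cite: AgasheRibetStein2012, §2.1] -/
theorem exists_congruenceNumber_mul_peterssonProduct_eq_self {f : CuspForm (Gamma0 N) k}
    (hf : f ∈ integralCuspForms0 N k) (hf0 : f ≠ 0) (hr : congruenceNumber f ≠ 0) :
    ∃ g ∈ integralCuspForms0 N k, (congruenceNumber f : ℂ) * peterssonProduct (Gamma0 N) k f g =
      peterssonProduct (Gamma0 N) k f f := by
  classical
  set L := integralCuspForms0 N k with hL
  set H : Submodule ℤ L := ((ℤ ∙ f) ⊔ integralOrthogonal0 f).comap L.subtype with hH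
  have hcard : Nat.card (L ⧸ H.toAddSubgroup) = congruenceNumber f := rfl
  -- the integers `n(x)` with `r_f ⟨f, x⟩ = n(x) ⟨f, f⟩` (before generalising `r_f`)
  have hex : ∀ x : L, ∃ n : ℤ, (congruenceNumber f : ℂ) * peterssonProduct (Gamma0 N) k f x =
      n * peterssonProduct (Gamma0 N) k f f := fun x ↦
    exists_int_congruenceNumber_mul_peterssonProduct_eq f x.2
  generalize hrdef : congruenceNumber f = r at hr hcard hex ⊢
  haveI : NeZero r := ⟨hr⟩
  have hrC : (r : ℂ) ≠ 0 := by exact_mod_cast hr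
  have hω0 : peterssonProduct (Gamma0 N) k f f ≠ 0 := by
    intro h0
    have hpos := peterssonProduct_self_pos_holds (Gamma0 N : Subgroup (GL (Fin 2) ℝ)) k hf0
    rw [h0, Complex.zero_re] at hpos
    exact lt_irrefl _ hpos
  choose n hn using hex
  have hn_unique : ∀ (x : L) (m : ℤ), (r : ℂ) * peterssonProduct (Gamma0 N) k f x =
      m * peterssonProduct (Gamma0 N) k f f → n x = m := fun x m hm ↦ by
    have h := (hn x).symm.trans hm
    exact_mod_cast mul_right_cancel₀ hω0 h
  have hn_add : ∀ x y : L, n (x + y) = n x + n y := fun x y ↦ by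
    refine hn_unique (x + y) (n x + n y) ?_
    rw [Submodule.coe_add, peterssonProduct_add_right, mul_add, hn x, hn y, Int.cast_add, add_mul]
  have hn_zero : n 0 = 0 := hn_unique 0 0 (by
    rw [Submodule.coe_zero, peterssonProduct_zero_right, mul_zero, Int.cast_zero, zero_mul])
  -- `ν : S_k(ℤ) →+ ℤ/r`, `x ↦ n(x) mod r`
  let ν : L →+ ZMod r :=
    { toFun := fun x ↦ ((n x : ℤ) : ZMod r)
      map_zero' := by simp only [hn_zero, Int.cast_zero]
      map_add' := fun x y ↦ by simp only [hn_add, Int.cast_add] }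
  have hν : ∀ x : L, ν x = ((n x : ℤ) : ZMod r) := fun _ ↦ rfl
  -- its kernel is `ℤf + (ℤf)^⊥`
  have hker : ν.ker = H.toAddSubgroup := by
    ext x
    rw [AddMonoidHom.mem_ker, hν, ZMod.intCast_zmod_eq_zero_iff_dvd, Submodule.mem_toAddSubgroup,
      hH, Submodule.mem_comap, Submodule.subtype_apply, Submodule.mem_sup]
    constructor
    · rintro ⟨a, ha⟩
      -- `n(x) = r a`, so `⟨f, x⟩ = a ⟨f, f⟩` and `x - a f ⊥ f`
      have hPx : peterssonProduct (Gamma0 N) k f x = a * peterssonProduct (Gamma0 N) k f f := by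
        have h := hn x
        rw [ha, Int.cast_mul, Int.cast_natCast, mul_assoc] at h
        exact mul_left_cancel₀ hrC h
      refine ⟨a • f, Submodule.mem_span_singleton.mpr ⟨a, rfl⟩,
        (x : CuspForm (Gamma0 N) k) - a • f, ?_, by abel⟩
      rw [mem_integralOrthogonal0]
      refine ⟨L.sub_mem x.2 (L.smul_mem a hf), ?_⟩
      rw [sub_eq_add_neg, peterssonProduct_add_right, ← neg_zsmul, peterssonProduct_zsmul_right,
        Int.cast_neg, neg_mul, hPx, add_neg_cancel]
    · rintro ⟨y, hy, z, hz, hyz⟩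
      obtain ⟨a, rfl⟩ := Submodule.mem_span_singleton.mp hy
      have hPz : peterssonProduct (Gamma0 N) k f z = 0 := (mem_integralOrthogonal0.mp hz).2
      refine ⟨a, hn_unique x (r * a) ?_⟩
      have e := congrArg (peterssonProduct (Gamma0 N) k f) hyz
      rw [peterssonProduct_add_right, peterssonProduct_zsmul_right, hPz, add_zero] at e
      rw [← e, Int.cast_mul, Int.cast_natCast, mul_assoc]
  -- the quotient of order `r` injects into `ℤ/r`, hence `ν` is onto
  have hrange : ν.range = ⊤ := by
    have e1 : Nat.card ν.range = r := by
      rw [← Nat.card_congr (QuotientAddGroup.quotientKerEquivRange ν).toEquiv, hker, hcard]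
    haveI : Finite ν.range := Nat.finite_of_card_ne_zero (by rw [e1]; exact hr)
    exact AddSubgroup.eq_top_of_card_eq _ (by rw [e1, Nat.card_zmod])
  -- lift `1`: `n(x) = 1 - r m`
  obtain ⟨x, hx1⟩ : ∃ x : L, ν x = 1 := by
    have h1 : (1 : ZMod r) ∈ ν.range := by rw [hrange]; exact AddSubgroup.mem_top _
    exact h1
  have hdvd : (r : ℤ) ∣ 1 - n x := by
    rw [hν, ← Int.cast_one, ZMod.intCast_eq_intCast_iff_dvd_sub] at hx1
    exact hx1
  obtain ⟨m, hm⟩ := hdvd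
  -- `g = x + m f` has `n(g) = n(x) + r m = 1`
  refine ⟨(x : CuspForm (Gamma0 N) k) + m • f, L.add_mem x.2 (L.smul_mem m hf), ?_⟩
  rw [peterssonProduct_add_right, peterssonProduct_zsmul_right, mul_add, hn x, ← mul_assoc,
    ← add_mul]
  have hm' : ((n x : ℤ) : ℂ) + (r : ℂ) * (m : ℂ) = 1 := by
    have : (n x : ℤ) + (r : ℤ) * m = 1 := by linarith
    exact_mod_cast this
  rw [hm', one_mul]

/-- **Agashe–Ribet–Stein's definition (ii) ⇒ (i), in full: `r_f` is attained by a congruence.**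
If `0 ≠ f ∈ S_k(Γ₀(N); ℤ)` and `r_f = congruenceNumber f ≠ 0`, there are `g₁ ∈ (ℤf)^⊥` and
`h ∈ S_k(Γ₀(N); ℤ)` with `f - g₁ = r_f • h`, i.e. `aₙ(f) ≡ aₙ(g₁) (mod r_f)` for all `n` (ARS 2012,
§2.1: "(i) `r_E` is the largest integer `r` such that there exists `g ∈ (ℤf)^⊥` with
`f ≡ g mod r`"; the maximality is `dvd_congruenceNumber_of_sub_eq_smul`). From
`exists_congruenceNumber_mul_peterssonProduct_eq_self`: with `r_f ⟨f, h⟩ = ⟨f, f⟩`, the form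
`g₁ = f - r_f • h` is integral and orthogonal to `f`. [cite: AgasheRibetStein2012, §2.1]
[cite: AbbesUllmo1996, §3 p. 276 (i)–(ii)] -/
theorem exists_sub_eq_congruenceNumber_smul {f : CuspForm (Gamma0 N) k}
    (hf : f ∈ integralCuspForms0 N k) (hf0 : f ≠ 0) (hr : congruenceNumber f ≠ 0) :
    ∃ g₁ ∈ integralOrthogonal0 f, ∃ h ∈ integralCuspForms0 N k,
      f - g₁ = congruenceNumber f • h := by
  obtain ⟨h, hh, hPh⟩ := exists_congruenceNumber_mul_peterssonProduct_eq_self hf hf0 hr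
  generalize hrdef : congruenceNumber f = r at hPh ⊢
  refine ⟨f - (r : ℤ) • h, ?_, h, hh, ?_⟩
  · rw [mem_integralOrthogonal0]
    refine ⟨(integralCuspForms0 N k).sub_mem hf ((integralCuspForms0 N k).smul_mem _ hh), ?_⟩
    rw [sub_eq_add_neg, peterssonProduct_add_right, ← neg_zsmul, peterssonProduct_zsmul_right,
      Int.cast_neg, Int.cast_natCast, neg_mul, hPh, add_neg_cancel]
  · rw [sub_sub_cancel, natCast_zsmul]

end Cyclic

end Literature.NumberTheory.EllipticCurves.ModularForms

end
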